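import Literature.NumberTheory.Automorphic.HenniartAutomorphicInductionProofs
import HarnessLib

/-!
# The infinity type of an automorphic induction (`T ↦ (σ ↦ ∑_{σ' ∣ σ} T σ')`)

Topic `NumberTheory/Automorphic`; a definition file next to `InfinityType`,
`BaseChangeArchimedean` (`InfinityType.baseChange`, the infinity type of a base change lift:
restriction of embeddings) and `HenniartAutomorphicInduction*`.

Henniart 2012 (Thm. 5 and the Remarque finale of §3.7, with Henniart 2010): the component of the
automorphic induction `τ^{E/F}` at an infinite place `v` of `F` is the local automorphic
induction of `τ_v`, i.e. on Langlands parameters `⊕_{w ∣ v} Ind_{W_{E_w}}^{W_{F_v}} φ_{τ_w}`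
(§1.12); restricted to `ℂ^× ≤ W_{F_v}` at an embedding `σ : F → ℂ` inducing `v` this is the direct
sum, over the embeddings `σ' : E → ℂ` extending `σ`, of the restrictions `z ↦ z^{a} z̄^{b}` of the
parameters of `τ` at `σ'` (for `E_w = ℂ`, `F_v = ℝ`: `Ind_{W_ℂ}^{W_ℝ}(z^a z̄^b)|_{ℂ^×} =
z^a z̄^b ⊕ z^b z̄^a`, the weights of `τ` at `σ'` and at `σ̄'`). In the tree's vocabulary of
infinity types (`InfinityType K n = (K →+* ℂ) → Multiset ArchWeight`, Clozel 1990 §3.3,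
Buzzard–Gee 2014 §3.1) this is the operation

  `T ↦ T^{L/K}`, `T^{L/K}(σ) = ∑_{σ' ∣ σ} T(σ')`,

which this file names `InfinityType.automorphicInduction` and equips with its bookkeeping:
well-formedness (`[L : K] n` weights at each `σ`; compatibility with complex conjugation, since
`σ' ↦ σ̄'` maps the embeddings over `σ` onto those over `σ̄`), `L`-algebraicity (the exponents
are the same numbers; automorphic induction preserves `L`-, not `C`-algebraicity: the shift
`(N-1)/2 - (n-1)/2 = n([L:K]-1)/2` need not be an integer), the regularity criterion, and the
reading of the named fact `Henniart2012_infinityType_of_automorphicInduction` as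
"`P` has the infinity type `T_π^{L/K}`" (`….hasInfinityType_automorphicInduction`), together with
the generic passage from an archimedean-parameter clause `χ ↦ (σ ↦ ∑_{σ' ∣ σ} χ σ')` (the shape
of the archimedean statements of `HenniartAutomorphicInductionAssembly`) to infinity types.

Nothing here is a named fact; the one definition is `InfinityType.automorphicInduction`.

## References

* G. Henniart, *Induction automorphe globale pour les corps de nombres*, Bull. Soc. Math. France
  140 (2012) 1–17: §1.12, Thm. 5 and Remarque finale §3.7. [Henniart2012]
* G. Henniart, *Induction automorphe pour GL(n, ℂ)*, J. Funct. Anal. 258 (2010) 3082–3096.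
  [Henniart2010]
* L. Clozel, *Motifs et formes automorphes* (1990), §3.3. [Clozel1990]
* K. Buzzard, T. Gee, *The conjectural connections between automorphic representations and
  Galois representations* (2014), §3.1. [BuzzardGee2014]
-/

noncomputable section

open scoped NumberField Classical
open NumberField Finset Literature.NumberTheory.Automorphic

namespace Literature.NumberTheory.Automorphic

/-- **The infinity type of an automorphic induction along `L/K`**: `T^{L/K}(σ) = ∑_{σ' ∣ σ} T(σ')`,
the sum over the embeddings `σ' : L → ℂ` extending `σ : K → ℂ` (Henniart 2012, Thm. 5 and
Remarque finale §3.7 with §1.12: the archimedean components of `τ^{E/F}` are the local automorphic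
inductions, induction of parameters from `W_{E_w}` to `W_{F_v}`, read on the restrictions to
`ℂ^×`). The rank `N` of the result is a free parameter (an infinity type only carries its rank
through well-formedness, which holds for `N = n [L : K]`,
`InfinityType.IsWellFormed.automorphicInduction`). [cite: Henniart2012, Thm. 5 and Remarque finale §3.7]
[cite: Clozel1990, §3.3] -/
def InfinityType.automorphicInduction (K : Type*) [Field K] {L : Type*} [Field L] [Algebra K L]
    [Fintype (L →+* ℂ)] {n : ℕ} (N : ℕ) (T : InfinityType L n) : InfinityType K N :=
  fun σ => ∑ σ' ∈ Finset.univ.filter (fun σ' : L →+* ℂ => σ'.comp (algebraMap K L) = σ), T σ'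

namespace InfinityType

section General

variable {K : Type*} [Field K] {L : Type*} [Field L] [Algebra K L] [Fintype (L →+* ℂ)] {n N : ℕ}

/-- Unfolding `InfinityType.automorphicInduction`. [folklore] -/
@[simp] theorem automorphicInduction_apply (T : InfinityType L n) (σ : K →+* ℂ) :
    T.automorphicInduction K N σ =
      ∑ σ' ∈ Finset.univ.filter (fun σ' : L →+* ℂ => σ'.comp (algebraMap K L) = σ), T σ' :=
  rfl

/-- Mapping the weights commutes with the sum over `σ' ∣ σ` (in particular for the `z`-exponents
`ArchWeight.a`). [folklore] -/
theorem map_automorphicInduction {γ : Type*} (T : InfinityType L n) (g : ArchWeight → γ)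
    (σ : K →+* ℂ) :
    (T.automorphicInduction K N σ).map g =
      ∑ σ' ∈ Finset.univ.filter (fun σ' : L →+* ℂ => σ'.comp (algebraMap K L) = σ),
        (T σ').map g :=
  map_sum (Multiset.mapAddMonoidHom g) _ _

/-- **Conjugation maps the embeddings over `σ` onto those over `σ̄`**: the induced type at `σ̄` is
the sum of `T(σ̄')` over `σ' ∣ σ`. [folklore] -/
theorem automorphicInduction_conjugate (T : InfinityType L n) (σ : K →+* ℂ) :
    T.automorphicInduction K N (ComplexEmbedding.conjugate σ) =
      ∑ σ' ∈ Finset.univ.filter (fun σ' : L →+* ℂ => σ'.comp (algebraMap K L) = σ),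
        T (ComplexEmbedding.conjugate σ') := by
  rw [automorphicInduction_apply]
  refine Finset.sum_nbij' (fun σ' => ComplexEmbedding.conjugate σ')
    (fun σ' => ComplexEmbedding.conjugate σ') ?_ ?_ ?_ ?_ ?_
  · intro σ' hσ'
    simp only [mem_filter, mem_univ, true_and] at hσ' ⊢
    rw [ComplexEmbedding.conjugate_comp, hσ', ComplexEmbedding.involutive_conjugate K σ]
  · intro σ' hσ'
    simp only [mem_filter, mem_univ, true_and] at hσ' ⊢
    rw [ComplexEmbedding.conjugate_comp, hσ']
  · intro σ' _
    exact ComplexEmbedding.involutive_conjugate L σ'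
  · intro σ' _
    exact ComplexEmbedding.involutive_conjugate L σ'
  · intro σ' _
    rw [ComplexEmbedding.involutive_conjugate L σ']

/-- **Automorphic induction preserves `L`-algebraicity of an infinity type** (the exponents are
the same numbers; Buzzard–Gee 2014, Def. 3.1.1). [cite: BuzzardGee2014, Def. 3.1.1] -/
theorem IsLAlgebraic.automorphicInduction {T : InfinityType L n} (h : T.IsLAlgebraic) :
    (T.automorphicInduction K N).IsLAlgebraic := by
  intro σ p hp
  obtain ⟨σ', -, hp'⟩ := Multiset.mem_sum.mp hp
  exact h σ' p hp'

/-- **Regularity of the induced type**: `T^{L/K}` is regular iff at every `σ : K → ℂ` the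
`z`-exponents of `T` at the embeddings `σ' ∣ σ`, taken together, are pairwise distinct
(Clozel 1990, Déf. 3.12). [cite: Clozel1990, Déf. 3.12] -/
theorem isRegular_automorphicInduction_iff (T : InfinityType L n) :
    (T.automorphicInduction K N).IsRegular ↔
      ∀ σ : K →+* ℂ, (∑ σ' ∈ Finset.univ.filter (fun σ' : L →+* ℂ => σ'.comp (algebraMap K L) = σ),
        (T σ').map ArchWeight.a).Nodup := by
  refine forall_congr' fun σ => ?_
  rw [map_automorphicInduction]

/-- A summand of a regular induced type is regular: if `T^{L/K}` is regular then so is `T`.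
[cite: Clozel1990, Déf. 3.12] -/
theorem IsRegular.of_automorphicInduction {T : InfinityType L n}
    (h : (T.automorphicInduction K N).IsRegular) : T.IsRegular := by
  intro σ'
  have hσ := (isRegular_automorphicInduction_iff T).mp h (σ'.comp (algebraMap K L))
  refine Multiset.nodup_of_le ?_ hσ
  exact Finset.single_le_sum (f := fun σ'' : L →+* ℂ => (T σ'').map ArchWeight.a)
    (fun _ _ => Multiset.zero_le _) (Finset.mem_filter.mpr ⟨Finset.mem_univ _, rfl⟩)

end General

section NumberField

variable {K : Type} [Field K] [NumberField K] {L : Type} [Field L] [NumberField L] [Algebra K L]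
  {n N : ℕ}

/-- **The induced infinity type is well formed** for the rank `N = n [L : K]`: `[L : K] n` weights
at each `σ` (every `σ` has `[L : K]` extensions to `L`), and compatibility with complex
conjugation (conjugation maps the embeddings over `σ` onto those over `σ̄`, and `T(σ̄') =
T(σ')^{swap}`). [cite: Clozel1990, §3.3] [cite: BuzzardGee2014, §3.1] -/
theorem IsWellFormed.automorphicInduction {T : InfinityType L n} (h : T.IsWellFormed)
    (hN : N = n * Module.finrank K L) : (T.automorphicInduction K N).IsWellFormed := by
  refine ⟨fun σ => ?_, fun σ => ?_⟩
  · rw [automorphicInduction_apply, Multiset.card_sum,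
      Finset.sum_congr rfl fun σ' _ => h.1 σ', Finset.sum_const, smul_eq_mul,
      card_filter_comp_algebraMap_eq', hN, Nat.mul_comm]
  · rw [automorphicInduction_conjugate, map_automorphicInduction]
    exact Finset.sum_congr rfl fun σ' _ => h.2 σ'

end NumberField

end InfinityType

/-! ### From an archimedean-parameter clause to infinity types -/

section ArchParameter

variable {K : Type} [Field K] [NumberField K] {L : Type} [Field L] [NumberField L] [Algebra K L]
  {n N : ℕ} {hK : isCompact_glFiniteIntegralLevel N K} {hL : isCompact_glFiniteIntegralLevel n L}

/-- **An automorphic induction with the expected archimedean parameter has the induced infinity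
type.** If `π` on `GL_n(𝔸_L)` has infinity type `T` and `P` on `GL_N(𝔸_K)`, `N = n [L : K]`, has
the archimedean parameter `σ ↦ ∑_{σ' ∣ σ} (T σ').map a` (the archimedean clause of Henniart 2012,
Thm. 5 and Remarque finale §3.7, in the shape of `HenniartAutomorphicInductionAssembly`), then `P`
has infinity type `T^{L/K}`. [cite: Henniart2012, Thm. 5 and Remarque finale §3.7]
[cite: Clozel1990, §3.3] -/
theorem AutomorphicRepData.HasInfinityType.automorphicInduction_of_hasArchParameter
    {π : AutomorphicRepData (AutomorphyDatum.gl n L hL)}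
    {P : AutomorphicRepData (AutomorphyDatum.gl N K hK)} {T : InfinityType L n}
    (hT : π.HasInfinityType T) (hN : N = n * Module.finrank K L)
    (hP : P.HasArchParameter fun σ =>
      ∑ σ' ∈ Finset.univ.filter (fun σ' : L →+* ℂ => σ'.comp (algebraMap K L) = σ),
        (T σ').map ArchWeight.a) :
    P.HasInfinityType (T.automorphicInduction K N) := by
  refine ⟨hT.1.automorphicInduction hN, ?_⟩
  have e : (fun σ : K →+* ℂ => (T.automorphicInduction K N σ).map ArchWeight.a) =
      fun σ => ∑ σ' ∈ Finset.univ.filter (fun σ' : L →+* ℂ => σ'.comp (algebraMap K L) = σ),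
        (T σ').map ArchWeight.a :=
    funext fun σ => InfinityType.map_automorphicInduction T ArchWeight.a σ
  rw [e]
  exact hP

end ArchParameter

/-! ### Henniart's named fact read as "`P` has the infinity type `T_π^{L/K}`" -/

section Henniart

/-- **`Henniart2012_infinityType_of_automorphicInduction` on induced infinity types**: granted the
named fact, if a cuspidal `P` on `GL_{dn}(𝔸_K)` is automorphically induced from a cuspidal `π` on
`GL_n(𝔸_L)` (`L/K` cyclic of degree `d`) and `P`, `π` have infinity types `T_P`, `T_π`, then `P`
has the infinity type `T_π^{L/K}` (Henniart 2012, Thm. 5 and Remarque finale §3.7: the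
archimedean components of `τ^{E/F}` are the local automorphic inductions). The hypothesis `T_P`
is only used through its existence (`HasInfinityType` pins the `a`-multisets, which the fact
identifies with those of `T_π^{L/K}`). [cite: Henniart2012, §1.10, Thm. 3 (i), Thm. 5 and Remarque §3.7]
[cite: Clozel1990, §3.3] -/
theorem Henniart2012_infinityType_of_automorphicInduction.hasInfinityType_automorphicInduction
    (h : Henniart2012_infinityType_of_automorphicInduction)
    (K L : Type) [Field K] [NumberField K] [Field L] [NumberField L] [Algebra K L] [IsGalois K L]
    (hcyc : IsCyclic (L ≃ₐ[K] L)) (n d : ℕ) (hn : 0 < n) (hd : Module.finrank K L = d)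
    (hK : isCompact_glFiniteIntegralLevel (d * n) K) (hL : isCompact_glFiniteIntegralLevel n L)
    (P : CuspidalAutomorphicRepData (d * n) K hK) (π : CuspidalAutomorphicRepData n L hL)
    (hAI : IsAutomorphicInductionAlong π.1 P.1) {TP : InfinityType K (d * n)}
    {Tπ : InfinityType L n} (hTP : P.1.HasInfinityType TP) (hTπ : π.1.HasInfinityType Tπ) :
    P.1.HasInfinityType (Tπ.automorphicInduction K (d * n)) := by
  refine hTπ.automorphicInduction_of_hasArchParameter (by rw [hd, Nat.mul_comm]) ?_
  have e : (fun σ : K →+* ℂ => (TP σ).map ArchWeight.a) =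
      fun σ => ∑ σ' ∈ Finset.univ.filter (fun σ' : L →+* ℂ => σ'.comp (algebraMap K L) = σ),
        (Tπ σ').map ArchWeight.a :=
    funext fun σ => Henniart2012_infinityType_of_automorphicInduction_iff_along.mp h K L hcyc n d
      hn hd hK hL P π hAI TP Tπ hTP hTπ σ
  exact e ▸ hTP.2

/-- Conversely, **the conclusion of the named fact for the pair `(T_π^{L/K}, T_π)` is automatic**:
`(T_π^{L/K} σ).map a = ∑_{σ' ∣ σ} (T_π σ').map a` by definition; so, by the invariance of the
conclusion under the choice of infinity types (`map_a_eq_sum_iff_of_hasInfinityType`), the named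
fact is equivalent to: whenever `P` (cuspidal, automorphically induced from `π`) and `π` have
infinity types at all, `P` has the infinity type `T_π^{L/K}` for every infinity type `T_π` of `π`.
[cite: Henniart2012, §1.10, Thm. 3 (i), Thm. 5 and Remarque §3.7] [cite: Clozel1990, §3.3] -/
theorem Henniart2012_infinityType_of_automorphicInduction_iff_hasInfinityType_automorphicInduction :
    Henniart2012_infinityType_of_automorphicInduction ↔
      ∀ (K L : Type) [Field K] [NumberField K] [Field L] [NumberField L] [Algebra K L]
        [IsGalois K L], IsCyclic (L ≃ₐ[K] L) →
        ∀ (n d : ℕ), 0 < n → Module.finrank K L = d →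
        ∀ (hK : isCompact_glFiniteIntegralLevel (d * n) K)
          (hL : isCompact_glFiniteIntegralLevel n L)
          (P : CuspidalAutomorphicRepData (d * n) K hK) (π : CuspidalAutomorphicRepData n L hL),
          IsAutomorphicInductionAlong π.1 P.1 → P.1.exists_hasInfinityType →
          ∀ Tπ : InfinityType L n, π.1.HasInfinityType Tπ →
            P.1.HasInfinityType (Tπ.automorphicInduction K (d * n)) := by
  constructor
  · intro h K L _ _ _ _ _ _ hcyc n d hn hd hK hL P π hAI hP Tπ hTπ
    obtain ⟨TP, hTP⟩ := hP
    exact h.hasInfinityType_automorphicInduction K L hcyc n d hn hd hK hL P π hAI hTP hTπ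
  · intro h
    rw [Henniart2012_infinityType_of_automorphicInduction_iff_along]
    intro K L _ _ _ _ _ _ hcyc n d hn hd hK hL P π hAI TP Tπ hTP hTπ σ
    have hind := h K L hcyc n d hn hd hK hL P π hAI ⟨TP, hTP⟩ Tπ hTπ
    have e := P.1.hasArchParameter_unique hTP.2 hind.2
    have := congr_fun e σ
    simpa only [InfinityType.map_automorphicInduction] using this

end Henniart

end Literature.NumberTheory.Automorphic
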